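import Summits.BirchSwinnertonDyer.BirchSwinnertonDyer.Theorems.ByReductionTypeAtTwoMultTowerLocalAddvPotGoodIndex
import HarnessLib

/-!
# Route `ByReductionTypeAtTwo`, crux `MultUpperHalfAtTwo` (item stmt-BirchSwinnertonDyer-19922): ONE BIT at an odd ADDITIVE prime of
# POTENTIALLY GOOD type — part 2: `#E(K_v^nr)[p^∞] ≤ 3` at an additive `v ∤ p` of Kodaira type `≠ I_n*`

Part 2 of 3: the tree's `finite_and_natCard_inertiaFixed_primary_le_four_of_hasAdditiveReduction`
(`Greenberg1999/ControlLocalKernelsLayerAdditiveProofs`) VERBATIM with the index bound `≤ 3` of part 1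
(`index_nonsingularReductionSubgroup_map_le_three_of_isAdditive_of_ne_Istar`): the inertia-fixed `p`-power torsion of `E(K̄_v)` injects
into `J(K_v^nr)/E₀` (cusp: `E₀` has no prime-to-`v` torsion), of order `≤ 3`.
HONEST FRAMING (cell `bsd-2adic`, run/shared/lean/pub/bsd-2adic/, seat `bsd-2adic-mult-2` GEN 8, HUMAN RULINGS D-0036 / D-0054 /
D-0074 row (A)): research route; THEOREMS ONLY — no definition, no new named fact; nothing is booked; BSD is not proved by any of
this. PARTITION: X5@2 mult (K4ᵐ, RESIDUAL-MAP B1·O1; the 1 680 `E[2]`-irreducible classes) × p = 2 — types-the-object-of (the per-prime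
local constant of the TOWER-gap certificate of item 19922 at an odd additive prime of potentially good type); closes none.
WHAT IS DISPLAYED, NOT PROVED: nothing. ∀-LEVEL CONTENT: none.
References: R. Greenberg, LNM 1716 (1999), §3 Lemma 3.3 (pp. 86–88); J. H. Silverman, *AEC* (2009) Thm. VII.6.1; *ATAEC* (1994) IV.9.4,
Table 4.1, Cor. IV.9.2(d).
-/

set_option autoImplicit false
-- the Theorems namespace of this sub repeats the summit name by design (D-0017 nested layout: Summit.<S>.<Sub>)
set_option linter.dupNamespace false

noncomputable section

open scoped Classical NNReal
open NumberField IsDedekindDomain Field Polynomial IsLocalRing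

universe u

/-! ## §2 `#E(K_v^nr)[p^∞] ≤ 3` at an additive `v ∤ p` of potentially good type -/

namespace WeierstrassCurve

open Literature.NumberTheory.EllipticCurves Literature.NumberTheory.EllipticCurves.LocalIndex
  Literature.NumberTheory.GaloisRepresentations
  Literature.NumberTheory.GaloisRepresentations.IsNonarchimedeanLocalField
  Literature.NumberTheory.DiophantineGeometry Literature.NumberTheory.DiophantineGeometry.TateAlgorithm
  IsDedekindDomain IsDedekindDomain.HeightOneSpectrum

section Local

variable {K : Type u} [Field K] [NumberField K] {v : HeightOneSpectrum (𝓞 K)}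
  (X : WeierstrassCurve (v.adicCompletion K))

set_option maxHeartbeats 4000000 in
/-- **At an additive place `v ∤ p` of Kodaira type other than `I_n*` the inertia-fixed `p`-power torsion of `E(K̄_v)` has at
most `3` elements** — the tree's `finite_and_natCard_inertiaFixed_primary_le_four_of_hasAdditiveReduction` VERBATIM with the index bound
`≤ 3` of `index_nonsingularReductionSubgroup_map_le_three_of_isAdditive_of_ne_Istar`. ORIGINAL DOCSTRING: **At an additive place `v ∤ p` the inertia-fixed `p`-power torsion of `E(K̄_v)` has at most `4`
elements** (`H⁰(I_v, E[p^∞]) ↪ E(K_v^nr)/E₀(K_v^nr) = Φ_v(k̄_v)`, of order `c̄_v ≤ 4`: Greenberg, LNM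
1716, p. 88; Silverman *AEC* Thm. VII.6.1). For an elliptic curve over `K_v` given by a minimal
Weierstrass equation `X` with ADDITIVE reduction, `w` the spectral valuation, `𝔐` the prime of
`\bar 𝓞_v` above `𝓂_v` and a prime `p` with `v ∤ p`: the points `P ∈ X(K̄_v)` fixed by `I_𝔐` and killed
by a power of `p` are finitely many, at most `4`. Proof: they come from `J(K_v^nr)` (`J = X₀ ⊗ 𝒪ⁿʳ`);
the `p`-power torsion of `J(K_v^nr)` meets `E₀` trivially (cusp: `eq_zero_of_zsmul_eq_zero_of_cusp`
on the `𝒪_w`-model), hence injects into `J(K_v^nr)/E₀`, of order `[J(K_v^nr) : E₀] ≤ 4`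
(`index_nonsingularReductionSubgroup_map_le_four_of_isAdditive`). Steps (1)–(4) are those of
`exists_inertia_map_ne_of_hasAdditiveReduction`, verbatim.
[cite: GreenbergLNM1716, §3 Lemma 3.3 (proof, PDF p. 88)]
[cite: SilvermanAEC2009, Thm. VII.6.1 with Cor. VII.6.2 (PDF p. 177) and proof of Thm. VII.7.1 (PDF p. 179)]
[cite: SilvermanATAEC1994, Cor. IV.9.2(d) and Rem. IV.9.2.2 (PDF p. 340)] -/
theorem finite_and_natCard_inertiaFixed_primary_le_three_of_hasAdditiveReduction_of_ne_Istar [hXell : X.IsElliptic]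
    [hadd : X.HasAdditiveReduction (v.adicCompletionIntegers K)]
    (w : Valuation (AlgebraicClosure (v.adicCompletion K)) ℝ≥0)
    (hw : ∀ x, (w x : ℝ) =
      spectralNorm (v.adicCompletion K) (AlgebraicClosure (v.adicCompletion K)) x)
    {𝔐 : Ideal (localAbsIntegers v)} (h𝔐 : 𝔐 ∈ v.localPrimesAbove)
    {p : ℕ} (hp : p.Prime) (hpv : (p : 𝓞 K) ∉ v.asIdeal)
    (hpg : ∀ n, (X.integralModel (v.adicCompletionIntegers K)).kodairaSymbolOfMinimal ≠ .Istar n) :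
    Finite {P : (X.baseChange (AlgebraicClosure (v.adicCompletion K))).toAffine.Point //
        (∀ σ ∈ 𝔐.inertia (absoluteGaloisGroup (v.adicCompletion K)),
          Affine.Point.map ((absoluteGaloisGroup.toAlgEquiv _ σ :
              AlgebraicClosure (v.adicCompletion K) ≃ₐ[v.adicCompletion K]
                AlgebraicClosure (v.adicCompletion K)) :
              AlgebraicClosure (v.adicCompletion K) →ₐ[v.adicCompletion K]
                AlgebraicClosure (v.adicCompletion K)) P = P) ∧
        ∃ k : ℕ, p ^ k • P = 0} ∧
      Nat.card {P : (X.baseChange (AlgebraicClosure (v.adicCompletion K))).toAffine.Point //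
        (∀ σ ∈ 𝔐.inertia (absoluteGaloisGroup (v.adicCompletion K)),
          Affine.Point.map ((absoluteGaloisGroup.toAlgEquiv _ σ :
              AlgebraicClosure (v.adicCompletion K) ≃ₐ[v.adicCompletion K]
                AlgebraicClosure (v.adicCompletion K)) :
              AlgebraicClosure (v.adicCompletion K) →ₐ[v.adicCompletion K]
                AlgebraicClosure (v.adicCompletion K)) P = P) ∧
        ∃ k : ℕ, p ^ k • P = 0} ≤ 3 := by
  -- the setting and steps (1)–(4) of `exists_nsmul_reducesToNonsingular_le_four_of_hasAdditiveReduction`, verbatim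
  haveI hXmin : X.IsMinimal (v.adicCompletionIntegers K) := hadd.toIsMinimal
  -- the classical decidable equality on `K_v^nr`, as in the index theorems of the tree
  letI instDec : DecidableEq (maxUnramified (v.adicCompletion K)) := fun a b => Classical.propDecidable (a = b)
  haveI := isDiscreteValuationRing_unrIntegers hw
  haveI := henselianLocalRing_unrIntegers hw
  haveI : PerfectField (ResidueField (v.adicCompletionIntegers K)) := PerfectField.ofFinite
  obtain ⟨φ, hφ⟩ := exists_ringHom_adicCompletionIntegers_unrIntegers hw
  obtain ⟨ψ, hψ⟩ := exists_ringHom_unrIntegers_integer (w := w)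
  have hvR := integers_valuationRing_valuation (Valuation.valuationSubring (Valuation.comap (algebraMap (maxUnramified (v.adicCompletion K)) (AlgebraicClosure (v.adicCompletion K))) w)) (maxUnramified (v.adicCompletion K))
  have hinjR := IsFractionRing.injective (Valuation.valuationSubring (Valuation.comap (algebraMap (maxUnramified (v.adicCompletion K)) (AlgebraicClosure (v.adicCompletion K))) w)) (maxUnramified (v.adicCompletion K))
  have hX₀K : (X.integralModel (v.adicCompletionIntegers K)).baseChange (v.adicCompletion K) = X :=
    WeierstrassCurve.baseChange_integralModel_eq (v.adicCompletionIntegers K) X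
  have hΔ : (X.integralModel (v.adicCompletionIntegers K)).Δ ≠ 0 := fun h0 ↦ by
    refine hXell.isUnit.ne_zero ?_
    rw [← hX₀K]
    change ((X.integralModel (v.adicCompletionIntegers K)).map (algebraMap _ _)).Δ = 0
    rw [WeierstrassCurve.map_Δ, h0, map_zero]
  /- (1) the index of `E₀` in `J(K_v^nr)`, `J = X₀ ⊗ 𝒪ⁿʳ`, is `≠ 0` and `≤ 4` (additive type) -/
  have hΔm : (X.integralModel (v.adicCompletionIntegers K)).Δ ∈ maximalIdeal (v.adicCompletionIntegers K) := by
    have h := hadd.badReduction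
    rw [← WeierstrassCurve.integralModel_Δ_eq (v.adicCompletionIntegers K) X] at h
    exact (valuation_lt_one_iff_mem _ _).mp h
  have hc₄m : (X.integralModel (v.adicCompletionIntegers K)).c₄ ∈ maximalIdeal (v.adicCompletionIntegers K) := by
    have h := hadd.additiveReduction
    rw [← WeierstrassCurve.integralModel_c₄_eq (v.adicCompletionIntegers K) X] at h
    exact (valuation_lt_one_iff_mem _ _).mp h
  have hmin : ((X.integralModel (v.adicCompletionIntegers K)).baseChange (v.adicCompletion K)).IsMinimal (v.adicCompletionIntegers K) := by
    rw [hX₀K]; exact hXmin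
  have hsym : (X.integralModel (v.adicCompletionIntegers K)).kodairaSymbolOfMinimal.IsAdditive :=
    (isAdditive_kodairaSymbolOfMinimal_iff (v.adicCompletion K) hΔ hmin).mpr ⟨hΔm, hc₄m⟩
  have hfin : (((X.integralModel (v.adicCompletionIntegers K)).map φ).nonsingularReductionSubgroup hvR).index ≠ 0 :=
    index_nonsingularReductionSubgroup_map_ne_zero_of_isAdditive hw hφ _ hΔ hsym
  have hle4 : (((X.integralModel (v.adicCompletionIntegers K)).map φ).nonsingularReductionSubgroup hvR).index ≤ 3 :=
    index_nonsingularReductionSubgroup_map_le_three_of_isAdditive_of_ne_Istar hw hφ _ hΔ hsym hpg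
  /- the model `J = X₀ ⊗ 𝒪ⁿʳ`, its base changes to `K_v^nr` and to `𝒪_w`, `K̄_v` -/
  have hJ : ((X.integralModel (v.adicCompletionIntegers K)).map φ).baseChange (maxUnramified (v.adicCompletion K)) = X.baseChange (maxUnramified (v.adicCompletion K)) := by
    conv_rhs => rw [← hX₀K]
    change ((X.integralModel (v.adicCompletionIntegers K)).map φ).map (algebraMap _ _) =
      ((X.integralModel (v.adicCompletionIntegers K)).map (algebraMap (v.adicCompletionIntegers K) (v.adicCompletion K))).map (algebraMap (v.adicCompletion K) (maxUnramified (v.adicCompletion K)))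
    rw [WeierstrassCurve.map_map, WeierstrassCurve.map_map]
    congr 1
    refine RingHom.ext fun a ↦ Subtype.ext ?_
    change (((φ a : (Valuation.valuationSubring (Valuation.comap (algebraMap (maxUnramified (v.adicCompletion K)) (AlgebraicClosure (v.adicCompletion K))) w))) : (maxUnramified (v.adicCompletion K))) : (AlgebraicClosure (v.adicCompletion K))) = ((algebraMap (v.adicCompletion K) (maxUnramified (v.adicCompletion K)) (algebraMap (v.adicCompletionIntegers K) (v.adicCompletion K) a) : (maxUnramified (v.adicCompletion K))) : (AlgebraicClosure (v.adicCompletion K)))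
    rw [hφ, IntermediateField.coe_algebraMap_apply]
    rfl
  have hW₀ : (((X.integralModel (v.adicCompletionIntegers K)).map φ).map ψ).baseChange (AlgebraicClosure (v.adicCompletion K)) = X.baseChange (AlgebraicClosure (v.adicCompletion K)) := by
    conv_rhs => rw [← hX₀K]
    change (((X.integralModel (v.adicCompletionIntegers K)).map φ).map ψ).map (algebraMap _ _) =
      ((X.integralModel (v.adicCompletionIntegers K)).map (algebraMap (v.adicCompletionIntegers K) (v.adicCompletion K))).map (algebraMap (v.adicCompletion K) (AlgebraicClosure (v.adicCompletion K)))
    rw [WeierstrassCurve.map_map, WeierstrassCurve.map_map, WeierstrassCurve.map_map]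
    congr 1
    refine RingHom.ext fun a ↦ ?_
    change ((ψ (φ a) : w.integer) : (AlgebraicClosure (v.adicCompletion K))) = algebraMap (v.adicCompletion K) (AlgebraicClosure (v.adicCompletion K)) (algebraMap (v.adicCompletionIntegers K) (v.adicCompletion K) a)
    rw [hψ, hφ]
    rfl
  -- the residue field of `𝒪ⁿʳ` embeds into that of `𝒪_w`
  haveI hψloc : IsLocalHom ψ := ⟨fun a ha ↦ by
    by_contra hna
    have hmem : a ∈ maximalIdeal (Valuation.valuationSubring (Valuation.comap (algebraMap (maxUnramified (v.adicCompletion K)) (AlgebraicClosure (v.adicCompletion K))) w)) :=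
      (IsLocalRing.mem_maximalIdeal _).mpr (mem_nonunits_iff.mpr hna)
    have := (map_mem_maximalIdeal_integer_iff hψ a).mpr hmem
    exact (mem_nonunits_iff.mp ((IsLocalRing.mem_maximalIdeal _).mp this)) ha⟩
  have hκ : (((X.integralModel (v.adicCompletionIntegers K)).map φ).map ψ).map (residue w.integer) =
      ((((X.integralModel (v.adicCompletionIntegers K)).map φ).map (residue (Valuation.valuationSubring (Valuation.comap (algebraMap (maxUnramified (v.adicCompletion K)) (AlgebraicClosure (v.adicCompletion K))) w)))).map
        (IsLocalRing.ResidueField.map ψ)) := by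
    simp only [WeierstrassCurve.map_map]
    congr 1
  /- the maps on points: `J(K_v^nr) ≃ X(K_v^nr) → X(K̄_v)` -/
  set e₁ := WeierstrassCurve.Affine.Point.congrEquiv hJ with he₁
  set ι : (X.baseChange (maxUnramified (v.adicCompletion K))).toAffine.Point →+ (X.baseChange (AlgebraicClosure (v.adicCompletion K))).toAffine.Point :=
    WeierstrassCurve.Affine.Point.map (W' := X)
      (IsScalarTower.toAlgHom (v.adicCompletion K) (maxUnramified (v.adicCompletion K)) (AlgebraicClosure (v.adicCompletion K))) with hι
  -- (3) `I_𝔐`-fixed points of `X(K̄_v)` come from `X(K_v^nr)` (the tree's exported Step (3))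
  have hsurj : ∀ P : (X.baseChange (AlgebraicClosure (v.adicCompletion K))).toAffine.Point,
      (∀ σ ∈ 𝔐.inertia (absoluteGaloisGroup (v.adicCompletion K)),
        WeierstrassCurve.Affine.Point.map
          ((absoluteGaloisGroup.toAlgEquiv _ σ : (AlgebraicClosure (v.adicCompletion K)) ≃ₐ[(v.adicCompletion K)] (AlgebraicClosure (v.adicCompletion K))) : (AlgebraicClosure (v.adicCompletion K)) →ₐ[(v.adicCompletion K)] (AlgebraicClosure (v.adicCompletion K))) P = P) →
        ∃ Q, ι Q = P := fun P hP ↦ by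
    rw [hι]; exact X.exists_map_maxUnramified_eq_of_forall_inertia w hw h𝔐 P hP
  -- (4) `E₀` of `J` over `𝒪ⁿʳ` maps into `E₀` of `X` over `𝒪_w`
  have hE₀ : ∀ Q : (((X.integralModel (v.adicCompletionIntegers K)).map φ).baseChange (maxUnramified (v.adicCompletion K))).toAffine.Point,
      ((X.integralModel (v.adicCompletionIntegers K)).map φ).HasNonsingularReduction Q →
        ReducesToNonsingular w (residue w.integer) (ι (e₁ Q)) := by
    intro Q hQ
    rcases point_cases hvR Q with rfl | ⟨x, y, h, rfl, hx⟩ | ⟨a, b, h, rfl⟩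
    · rw [map_zero, map_zero]; exact reducesToNonsingular_zero
    · have hx' : 1 < w (x : (AlgebraicClosure (v.adicCompletion K))) := not_le.mp fun hle ↦
        (not_mem_range_iff hvR).mpr hx ⟨⟨x, (Valuation.mem_valuationSubring_iff _ _).mpr hle⟩, rfl⟩
      rw [he₁, WeierstrassCurve.Affine.Point.congrEquiv_some]
      exact reducesToNonsingular_of_one_lt hx'
    · have hns := (WeierstrassCurve.hasNonsingularReduction_some_algebraMap_iff hinjR h).mp hQ
      rw [he₁, WeierstrassCurve.Affine.Point.congrEquiv_some]
      -- transport to the `𝒪_w`-model `J ⊗ 𝒪_w` of `X ⊗ K̄ᵥ`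
      rw [← (WeierstrassCurve.Affine.Point.congrEquiv hW₀).apply_symm_apply (ι _),
        Literature.NumberTheory.EllipticCurves.reducesToNonsingular_congrEquiv_iff,
        reducesToNonsingular_iff_hasNonsingularReduction]
      change (((X.integralModel (v.adicCompletionIntegers K)).map φ).map ψ).HasNonsingularReduction
        ((WeierstrassCurve.Affine.Point.congrEquiv hW₀).symm
          (WeierstrassCurve.Affine.Point.some _ _ _))
      rw [WeierstrassCurve.Affine.Point.congrEquiv_symm_some]
      refine Or.inr ⟨ψ a, ψ b, hψ a, hψ b, ?_⟩
      rw [hκ, ← IsLocalRing.ResidueField.map_residue, ← IsLocalRing.ResidueField.map_residue]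
      exact (WeierstrassCurve.Affine.map_nonsingular _
        (IsLocalRing.ResidueField.map ψ).injective _ _).mpr hns
  /- (5) the count.  `T` = the `p`-power torsion of `J(K_v^nr)`; `H = E₀`. -/
  set H := ((X.integralModel (v.adicCompletionIntegers K)).map φ).nonsingularReductionSubgroup hvR with hH
  set T := AddCommGroup.primaryComponent
    ((((X.integralModel (v.adicCompletionIntegers K)).map φ).baseChange
      (maxUnramified (v.adicCompletion K))).toAffine.Point) p with hT
  -- valuations of `p^k`: `|p^k|_v = 1` on `K̄_v`
  have hpkw : ∀ k : ℕ, w (((p ^ k : ℕ) : ℤ) : AlgebraicClosure (v.adicCompletion K)) = 1 := fun k ↦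
    spectralValuation_intCast_eq_one hw (WeierstrassCurve.pow_natCast_not_mem hpv k)
  have hp0 : p ≠ 0 := hp.ne_zero
  haveI : CharZero (v.adicCompletion K) := charZero_of_injective_algebraMap (algebraMap K _).injective
  haveI : CharZero (AlgebraicClosure (v.adicCompletion K)) :=
    charZero_of_injective_algebraMap (algebraMap (v.adicCompletion K) _).injective
  -- the `𝒪_w`-model `W₀ = J ⊗ 𝒪_w` of `X ⊗ K̄_v` reduces to a CUSP
  have T1 : ∀ (a : (v.adicCompletionIntegers K)), a ∈ maximalIdeal (v.adicCompletionIntegers K) →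
      IsLocalRing.residue w.integer (ψ (φ a)) = 0 := by
    intro a ha
    have h1 := (map_mem_maximalIdeal_pow_iff hw hφ a 1).mpr (by rwa [pow_one])
    rw [pow_one] at h1
    exact (IsLocalRing.residue_eq_zero_iff _).mpr ((map_mem_maximalIdeal_integer_iff hψ (φ a)).mpr h1)
  have hΔ0 : IsLocalRing.residue w.integer
      (((X.integralModel (v.adicCompletionIntegers K)).map φ).map ψ).Δ = 0 := by
    rw [WeierstrassCurve.map_Δ, WeierstrassCurve.map_Δ]; exact T1 _ hΔm
  have hc₄0 : IsLocalRing.residue w.integer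
      (((X.integralModel (v.adicCompletionIntegers K)).map φ).map ψ).c₄ = 0 := by
    rw [WeierstrassCurve.map_c₄, WeierstrassCurve.map_c₄]; exact T1 _ hc₄m
  -- the maps `J(K_v^nr) → X(K̄_v)` are injective
  have hinjι' : Function.Injective ι := by rw [hι]; exact WeierstrassCurve.Affine.Point.map_injective _
  have hinj : Function.Injective (fun Q => ι (e₁ Q)) := fun a b hab => e₁.injective (hinjι' hab)
  -- (5a) `T ⊓ H = ⊥`: a `p`-power torsion point of `E₀(J)` is `O` (cusp)
  have hTH : ∀ Q, Q ∈ T → Q ∈ H → Q = 0 := by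
    intro Q hQT hQH
    obtain ⟨k, hk⟩ := (AddCommGroup.mem_primaryComponent).mp hQT
    have hpQ : ((p ^ k : ℕ) : ℤ) • Q = 0 := by rw [natCast_zsmul, hk]
    have hred : ReducesToNonsingular w (residue w.integer) (ι (e₁ Q)) := hE₀ Q hQH
    -- read on the `𝒪_w`-model
    set P' := (WeierstrassCurve.Affine.Point.congrEquiv hW₀).symm (ι (e₁ Q)) with hP'
    have hns : (((X.integralModel (v.adicCompletionIntegers K)).map φ).map ψ).HasNonsingularReduction P' := by
      rw [← reducesToNonsingular_iff_hasNonsingularReduction]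
      refine (Literature.NumberTheory.EllipticCurves.reducesToNonsingular_congrEquiv_iff _ hW₀ P').mp ?_
      rw [hP', AddEquiv.apply_symm_apply]
      exact hred
    have hpP' : ((p ^ k : ℕ) : ℤ) • P' = 0 := by
      rw [hP', ← map_zsmul, ← map_zsmul, ← map_zsmul, hpQ, map_zero, map_zero, map_zero]
    have hP'0 : P' = 0 := eq_zero_of_zsmul_eq_zero_of_cusp _ hΔ0 hc₄0 (hpkw k) hns hpP'
    have h1 := congrArg (WeierstrassCurve.Affine.Point.congrEquiv hW₀) hP'0
    rw [hP', AddEquiv.apply_symm_apply, map_zero] at h1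
    exact hinj (by simpa using h1)
  -- (5b) every `I_𝔐`-fixed `p`-power torsion point of `X(K̄_v)` comes from `T`
  have hlift : ∀ P : {P : (X.baseChange (AlgebraicClosure (v.adicCompletion K))).toAffine.Point //
        (∀ σ ∈ 𝔐.inertia (absoluteGaloisGroup (v.adicCompletion K)),
          Affine.Point.map ((absoluteGaloisGroup.toAlgEquiv _ σ :
              AlgebraicClosure (v.adicCompletion K) ≃ₐ[v.adicCompletion K]
                AlgebraicClosure (v.adicCompletion K)) :
              AlgebraicClosure (v.adicCompletion K) →ₐ[v.adicCompletion K]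
                AlgebraicClosure (v.adicCompletion K)) P = P) ∧
        ∃ k : ℕ, p ^ k • P = 0},
      ∃ Q : T, ι (e₁ (Q : _)) = (P : _) := by
    rintro ⟨P, hPI, k, hk⟩
    obtain ⟨P₀, hP₀⟩ := hsurj P hPI
    refine ⟨⟨e₁.symm P₀, ?_⟩, by rw [AddEquiv.apply_symm_apply, hP₀]⟩
    refine (AddCommGroup.mem_primaryComponent).mpr ⟨k, ?_⟩
    apply hinj
    change ι (e₁ (p ^ k • e₁.symm P₀)) = ι (e₁ 0)
    rw [map_nsmul, map_nsmul, AddEquiv.apply_symm_apply, hP₀, map_zero, map_zero, hk]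
  choose f hf using hlift
  have hfinj : Function.Injective f := fun P₁ P₂ h => Subtype.ext (by rw [← hf P₁, ← hf P₂, h])
  -- (5c) `T ↪ J(K_v^nr)/H`
  haveI hfinQ : Finite ((((X.integralModel (v.adicCompletionIntegers K)).map φ).baseChange
      (maxUnramified (v.adicCompletion K))).toAffine.Point ⧸ H) :=
    Nat.finite_of_card_ne_zero (by rw [← AddSubgroup.index_eq_card]; exact hfin)
  set g : T → ((((X.integralModel (v.adicCompletionIntegers K)).map φ).baseChange
      (maxUnramified (v.adicCompletion K))).toAffine.Point ⧸ H) :=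
    fun Q => (QuotientAddGroup.mk Q.1 : _ ⧸ H) with hg
  have hginj : Function.Injective g := by
    intro Q₁ Q₂ h
    apply Subtype.ext
    have h' : (QuotientAddGroup.mk Q₁.1 : _ ⧸ H) = QuotientAddGroup.mk Q₂.1 := h
    rw [QuotientAddGroup.eq] at h'
    have hmem : -Q₁.1 + Q₂.1 ∈ T := T.add_mem (T.neg_mem Q₁.2) Q₂.2
    have h0 := hTH _ hmem h'
    rwa [neg_add_eq_zero] at h0
  haveI hfinT : Finite T := Finite.of_injective g hginj
  -- the count: `#S ≤ #T ≤ [J : H] ≤ 4`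
  refine ⟨Finite.of_injective f hfinj, ?_⟩
  calc _ ≤ Nat.card T := Nat.card_le_card_of_injective f hfinj
    _ ≤ H.index := by rw [AddSubgroup.index_eq_card]; exact Nat.card_le_card_of_injective g hginj
    _ ≤ 3 := hle4


end Local

end WeierstrassCurve

end
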